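import Summits.AtomisticToContinuum.FouriersLaw.Theorems.BondHeatUncertaintyBoundedResponseBathHeat
import Summits.AtomisticToContinuum.FouriersLaw.Theorems.PhononMeanFreePathIncoherentChannelKineticAutocovTimeReversal
import HarnessLib

/-!
# BondHeatUncertainty / BoundedResponse — «BathHeat» ADDENDUM §6: the FORECAST door and its harmonic calibration
(decomp-a2c lens-1, g107, NODE 107 addendum, first file; blocker item stmt-AtomisticToContinuum-11071 = `BoundedResponse`)

Imports the landed NODE 107 main module `…BondHeatUncertaintyBoundedResponseBathHeat` (§4–§5: `bathKinCorr`, `bathTail`, the Props `BathHeatPoint`,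
`BathTailFloor/Ceiling`, `BathKernelFloor`, the doors) and ONE file of the dormant route `PhononMeanFreePath` (crux `IncoherentChannel`, line
`two-horizons-forecast-loss`): `…IncoherentChannelKineticAutocovTimeReversal` — the ECHO identity `K_N(s+u) = ⟨(P_uθ)∘Θ, P_sθ⟩_{μ_T}` and the
envelope `|K_N(2t)| ≤ ‖P_tθ‖²` for the near-bath kinetic autocovariance (their `A_N` on `N+1` sites = our `bathKinCorr … (N+1)`).
§7 (the PARITY form `K_N(2t) = F_N(t) − 2·Odd_N(t)`, (OFᶜ) ⟹ (BKᶠ), and the EQUIV (PDᶠ) ⟺ (BKᶠ)) is the sibling file `…BathHeatParity` (400-line cap).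

CONTENT.  `bathFcastSq` `F_N(t) := ‖P_t(p₀²) − T‖²_{L²(μ_T)}`; Props (FCᶜ_{p,α}) `BathForecastCeiling` (`F_N(t) ≤ A·N^p·t^{−α}`, `t ≥ t₀`, `N ≥ N₀`)
and (BKᵇ_{p,α}) `BathKernelBound` (two-sided `|K_N(r)| ≤ A·N^p·r^{−α}`).  Theorems: `abs_bathKinCorr_two_mul_le_bathFcastSq` (tree envelope in this
notation); ★ `bathKernelBound_of_bathForecastCeiling` (FCᶜ ⟹ BKᵇ, constant `2^α`); `bathKernelFloor_of_bathForecastCeiling`; ★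
`bathTailCeiling_of_bathKernelBound` (BKᵇ_{p,α} ⟹ BTᶜ_{max(p,0)+4−2α}, the ceiling twin of the node's floor bookkeeping); `bathTail_one_of_bathKernelBound`
(BKᵇ_{0,3/2} ⟹ BTᶜ_1 ∧ BTᶠ_1); ★★ `boundedResponse_iff_bathHeatPoint_of_bathForecastCeiling` **(FCᶜ_{0,3/2}) ⟹ (11071 ⟺ BHᴾ_1)** and
`boundedResponse_iff_heatSpreadPoint_of_bathForecastCeiling` **(FCᶜ_{0,3/2}) ⟹ (11071 ⟺ HSᴾ_3)** (no (S) involved); ★★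
`boundedResponse_of_subdiffusiveBondHeat_bathForecastCeiling` **(S) ∧ (FCᶜ_{0,3/2}) ⟹ 11071**.

HARMONIC CALIBRATION (by hand, recorded in the §6 docstring; it DECIDES THE TAGS).  In the harmonic chain `P_tθ = (v(t)·z)² − T(a+b)` (`v(t)` the
adjoint row of `p₀(t)`; `a+b` = dual energy of the adjoint packet emitted from site `0`), so `F_N(t) = 2T²(a+b)²`, `Odd_N(t) = 4T²ab`, `K_N(2t) = 2T²(a−b)²
≥ 0`; the packet loses dual energy only through the boundary momenta, hence `a+b → η₀ ∈ (0,1)` and **`F_N(t) → 2T²η₀² > 0` for `1 ≪ t ≪ N/c`**: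
(FCᶜ_{0,α}) (and (OFᶜ_{0,α}) of §7) are phonon-FALSE for every `α > 0` — an N-uniform forecast DECAY is an information-loss / finite-mean-free-path
statement (class of the dormant crux `PhononMeanFreePath.IncoherentChannel`), diffusive-true-leaning only, IDEA-NEEDED; (BKᶠ) holds there with `A = 0`
(AM–GM).  So: the theorems below are bookkeeping-exact, the door (FCᶜ_{0,3/2}) ⟹ (11071 ⟺ BHᴾ_1) is a genuine (S)-free reduction, but the (S)-side
door OF RECORD stays (BKᶠ_{0,3/2}) of §5 (parity form (PDᶠ) in §7).
Tags: (FCᶜ_{0,3/2}) INCOMPARABLE with 11071 (MustFailF M7/M10) · UNDECIDED · diffusive-TRUE-leaning · phonon-FALSE · IDEA-NEEDED; (BKᵇ_{0,3/2}) INCOMPARABLE ·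
UNDECIDED · TRUE-leaning (phonon: `|K_N| ≲ t^{−3}`).  No `sorry`; standard axioms; nothing here closes an item (3 def-like + 11 theorems).
-/

noncomputable section

open MeasureTheory ProbabilityTheory Filter Topology Set Function
open scoped NNReal ENNReal
open Literature.MathematicalPhysics.KineticTheory.HeatConduction
open Literature.MathematicalPhysics.KineticTheory OscillatorChain
open Literature.Probability.Process
open Summit.AtomisticToContinuum.FouriersLaw.Theorems.SubdiffusiveBondHeat
open Summit.AtomisticToContinuum.FouriersLaw.Theorems.SubdiffusiveBondHeat.EscapeGrading
open Summit.AtomisticToContinuum.FouriersLaw.Theorems.OddSectorIrreversibility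

namespace Summit.AtomisticToContinuum.FouriersLaw.Theorems.BoundedResponse.HeatSpreading

open Summit.AtomisticToContinuum.FouriersLaw.Theorems.BoundedResponse.TransientContact
open Summit.AtomisticToContinuum.FouriersLaw.Theorems.BoundedResponse.ParityFloor (extensiveBlockEnergyVariance_holds)
open Summit.AtomisticToContinuum.FouriersLaw.Theses.BondHeatUncertainty (BoundedResponse SubdiffusiveBondHeat)
/-! ## §6 The FORECAST door (addendum): a NORM CEILING on the boundary energy forecast gives the kernel floor

Tree input (route `PhononMeanFreePath`, crux `IncoherentChannel`, file `…IncoherentChannelKineticAutocovTimeReversal`): the ECHO identity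
`K_N(s+u) = ⟨(P_u θ)∘Θ, P_s θ⟩_{μ_T}` (`endKineticAutocov_timeReversal`; Chapman–Kolmogorov + detailed balance modulo the momentum flip `Θ`,
`θ = p₀² − T` is `Θ`-even) and its AM–GM consequence `|K_N(2t)| ≤ F_N(t) := ‖P_t θ‖²_{L²(μ_T)}` (`abs_endKineticAutocov_two_mul_le_energyForecast`,
with the site reflection `kinAutocov_kinFcastNorm_reflect`).  Hence a CEILING on the boundary ENERGY-FORECAST NORM — a squared `L²(μ_T)` norm of
`z ↦ E_z[p₀²(t)] − T`, i.e. a quantitative return-to-equilibrium rate for ONE observable, with the DIFFUSIVE half-line rate `t^{−3/2}` and NO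
amplitude — gives the TWO-SIDED kernel bound `|K_N(r)| ≤ 2^α A·r^{−α}` past `2t₀`, hence (BKᶠ_{p,α}) AND the tail ceiling, hence beneath it
`11071 ⟺ (BHᴾ_1)` outright and `(S) ⟹ 11071`.  §7 types the finer statement `K_N(2t) = ‖(P_tθ)⁺‖² − ‖(P_tθ)⁻‖²` (`Θ`-even/odd parts).

HARMONIC CALIBRATION (by hand; decides the tags).  In the harmonic chain `P_tθ = (v(t)·z)² − T(a+b)` with `v(t)` the adjoint row of `p₀(t)`,
`a = v_qΦ⁻¹v_qᵀ`, `b = v_p·v_pᵀ` (dual energy of the adjoint packet emitted from site `0`); so `F_N(t) = 2T²(a+b)²`, `Odd_N(t) = 4T²ab`,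
`K_N(2t) = 2T²(a−b)² ≥ 0`.  The packet loses dual energy ONLY through the boundary momenta (`d(a+b)/dt = −2γ[(v_p)_0² + (v_p)_{N−1}²]`), so
`a+b → η₀ := 1 − 2γ∫(v_p)_0² ∈ (0,1)` for `1 ≪ t ≪ N/c`: **`F_N(t) → 2T²η₀² > 0`** — (FCᶜ_{0,α}) is phonon-FALSE for every `α > 0` (coherent phonons
carry forecast information ballistically), while (BKᶠ) holds there with `A = 0` by AM–GM.  An N-uniform forecast DECAY is therefore an
information-loss / finite-MEAN-FREE-PATH statement (the class of the dormant crux `PhononMeanFreePath.IncoherentChannel`), true-leaning only in the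
diffusive (anharmonic, `T > 0`) regime and NOT cheap: tag IDEA-NEEDED, not ATTACKABLE.  The (S)-side door of record stays (BKᶠ_{0,3/2}) of §5, whose
honest parity form is the DOMINANCE statement (PDᶠ) of §7, not a smallness statement.
-/

/-- **Boundary ENERGY-FORECAST norm²** `F_N(t) := ‖P_t(p₀²) − T‖²_{L²(μ_T)} = ∫ ((∫ p₀² dP_t(z,·)) − T)² dμ_T(z)` (`N ≥ 1`; `0` for `N = 0`).
The `L²(μ_T)`-size of the best forecast of the boundary kinetic fluctuation at horizon `t`. [formal bookkeeping] -/
def bathFcastSq (ω₂ lam β γ T : ℝ) (N : ℕ) (t : ℝ) : ℝ :=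
  if h : 0 < N then
    ∫ z, ((∫ y, (y.2 ⟨0, h⟩) ^ 2 ∂((pinnedChain ω₂ lam β γ).transitionKernel N T T t.toNNReal z)) - T) ^ 2
      ∂((pinnedChain ω₂ lam β γ).gibbsMeasure N T)
  else 0

/-- **(FCᶜ_{p,α}) `BathForecastCeiling p α`** — N-uniform algebraic decay of the boundary energy-forecast norm:
`∃ A, t₀ > 0, N₀: ∀ N ≥ N₀ ∀ t ≥ t₀, F_N(t) ≤ A·N^p·t^{−α}`.  At `(p,α) = (0,3/2)`: the half-line (return-to-a-radiating-boundary) rate with no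
amplitude; DIFFUSIVE-regime scale `F_N(t) ≍ t^{−3/2}` up to the Thouless time and `≍ N^{−3}` there (memo H8) — but phonon-FALSE: in the harmonic chain
`F_N(t) → 2T²η₀² > 0` for `1 ≪ t ≪ N/c` (§6 calibration).  Tag: INCOMPARABLE with 11071 · UNDECIDED · diffusive-TRUE-leaning · phonon-FALSE ·
IDEA-NEEDED (an N-uniform `L²` information-loss RATE = mean-free-path class; weak-Poincaré / Nash inequalities would have to see the bulk anharmonic
scrambling, not only the boundary dissipation) · INSTRUMENTABLE only via `K_N` (`F_N ≥ |K_N(2t)|`). [route statement · this cell; NOT a literature fact] -/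
def BathForecastCeiling (p α : ℝ) : Prop :=
  ∀ ω₂ lam β γ : ℝ, 0 < ω₂ → 0 < lam → 0 < β → 0 < γ → ∀ T : ℝ, 0 < T →
    ∃ A t₀ : ℝ, 0 < t₀ ∧ ∃ N₀ : ℕ, ∀ N : ℕ, N₀ ≤ N → ∀ t : ℝ, t₀ ≤ t →
      bathFcastSq ω₂ lam β γ T N t ≤ A * (N : ℝ) ^ p * t ^ (-α)

/-- **(BKᵇ_{p,α}) `BathKernelBound p α`** — TWO-SIDED N-uniform kernel decay `|K_N(r)| ≤ A·N^p·r^{−α}` for `r ≥ r₀`, `N ≥ N₀`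
(implies (BKᶠ_{p,α}) and, integrated, both (BTᶠ) and (BTᶜ) at grade `max(p,0)+4−2α`). [route statement · this cell; NOT a literature fact] -/
def BathKernelBound (p α : ℝ) : Prop :=
  ∀ ω₂ lam β γ : ℝ, 0 < ω₂ → 0 < lam → 0 < β → 0 < γ → ∀ T : ℝ, 0 < T →
    ∃ A r₀ : ℝ, 0 < r₀ ∧ ∃ N₀ : ℕ, ∀ N : ℕ, N₀ ≤ N → ∀ r : ℝ, r₀ ≤ r →
      |bathKinCorr ω₂ lam β γ T N r| ≤ A * (N : ℝ) ^ p * r ^ (-α)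

section ForecastDoor

variable {ω₂ lam β γ : ℝ} (hω : 0 < ω₂) (hl : 0 < lam) (hβ : 0 < β) (hγ : 0 < γ) {T : ℝ} (hT : 0 < T)
include hω hl hβ hγ hT

/-- ★ **Forecast envelope** `|K_N(2t)| ≤ F_N(t)` (`N ≥ 2`, `t ≥ 0`) — the tree's `abs_endKineticAutocov_two_mul_le_energyForecast` (echo identity
+ AM–GM + site reflection) in this file's notation. [folklore] -/
theorem abs_bathKinCorr_two_mul_le_bathFcastSq {N : ℕ} (hN : 2 ≤ N) {t : ℝ} (ht : 0 ≤ t) :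
    |bathKinCorr ω₂ lam β γ T N (2 * t)| ≤ bathFcastSq ω₂ lam β γ T N t := by
  obtain ⟨n, rfl⟩ : ∃ n, N = n + 1 := ⟨N - 1, by omega⟩
  have h := PhononMeanFreePath.abs_endKineticAutocov_two_mul_le_energyForecast ω₂ lam β γ hω hl hβ hγ T hT n (by omega) t ht
  rw [← PhononMeanFreePath.kinAutocov_kinFcastNorm_reflect hω hl.le hβ.le hγ.le T n t.toNNReal] at h
  unfold bathKinCorr bathFcastSq
  rw [dif_pos (Nat.succ_pos n), dif_pos (Nat.succ_pos n)]
  exact h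

/-- A pointwise ceiling `K_N ≤ L` on `(0,∞)` integrates: `B_N(t) ≤ γ² ∫_{(0,∞)} min(r,t)·L(r) dr` (`L·min` integrable). [folklore] -/
theorem bathTail_le_of_ceiling {N : ℕ} (hN : 0 < N) {t : ℝ} (ht : 0 ≤ t) {L : ℝ → ℝ}
    (hLi : IntegrableOn (fun r : ℝ => min r t * L r) (Ioi 0))
    (hKL : ∀ r : ℝ, 0 < r → bathKinCorr ω₂ lam β γ T N r ≤ L r) :
    bathTail ω₂ lam β γ T N t ≤ γ ^ 2 * ∫ r in Ioi (0 : ℝ), min r t * L r := by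
  unfold bathTail
  have hmono : ∫ r in Ioi (0 : ℝ), min r t * bathKinCorr ω₂ lam β γ T N r ≤ ∫ r in Ioi (0 : ℝ), min r t * L r := by
    refine setIntegral_mono_on (integrableOn_min_mul_bathKinCorr hω hl hβ hγ hT hN ht) hLi measurableSet_Ioi
      (fun r hr => ?_)
    exact mul_le_mul_of_nonneg_left (hKL r hr) (le_min (le_of_lt hr) ht)
  exact mul_le_mul_of_nonneg_left hmono (sq_nonneg γ)

end ForecastDoor

section ForecastConsequences

/-- `(r/2)^{−α} = 2^α · r^{−α}` for `r > 0`. [folklore] -/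
theorem rpow_half_neg {r α : ℝ} (hr : 0 < r) : (r / 2) ^ (-α) = (2 : ℝ) ^ α * r ^ (-α) := by
  rw [Real.rpow_neg (by positivity), Real.div_rpow hr.le (by norm_num), Real.rpow_neg hr.le, inv_div, div_eq_mul_inv]

/-- ★ **(FCᶜ_{p,α}) ⟹ (BKᵇ_{p,α})**: the forecast ceiling gives the two-sided kernel bound past `2t₀` with constant `2^α·max(A,0)`. [this cell] -/
theorem bathKernelBound_of_bathForecastCeiling {p α : ℝ} (hF : BathForecastCeiling p α) : BathKernelBound p α := by
  intro ω₂ lam β γ hω hl hβ hγ T hT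
  obtain ⟨A, t₀, ht₀, N₀, hA⟩ := hF ω₂ lam β γ hω hl hβ hγ T hT
  refine ⟨(2 : ℝ) ^ α * max A 0, 2 * t₀, by positivity, max N₀ 2, fun N hN r hr => ?_⟩
  have hNN₀ : N₀ ≤ N := le_trans (le_max_left _ _) hN
  have hN2 : 2 ≤ N := le_trans (le_max_right _ _) hN
  have hr : 0 < r := by linarith
  have hNpos : (0 : ℝ) < N := by exact_mod_cast (show 0 < N by omega)
  have h1 := abs_bathKinCorr_two_mul_le_bathFcastSq hω hl hβ hγ hT hN2 (t := r / 2) (by positivity)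
  rw [show 2 * (r / 2) = r by ring] at h1
  have h2 := hA N hNN₀ (r / 2) (by linarith)
  rw [rpow_half_neg hr] at h2
  have hNp : 0 ≤ (N : ℝ) ^ p := Real.rpow_nonneg hNpos.le p
  have hrα : 0 ≤ r ^ (-α) := Real.rpow_nonneg hr.le _
  have h2α : 0 ≤ (2 : ℝ) ^ α := Real.rpow_nonneg (by norm_num) _
  have h3 : A * (N : ℝ) ^ p * ((2 : ℝ) ^ α * r ^ (-α)) ≤ max A 0 * (N : ℝ) ^ p * ((2 : ℝ) ^ α * r ^ (-α)) :=
    mul_le_mul_of_nonneg_right (mul_le_mul_of_nonneg_right (le_max_left _ _) hNp) (mul_nonneg h2α hrα)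
  calc |bathKinCorr ω₂ lam β γ T N r| ≤ max A 0 * (N : ℝ) ^ p * ((2 : ℝ) ^ α * r ^ (-α)) := le_trans h1 (le_trans h2 h3)
    _ = (2 : ℝ) ^ α * max A 0 * (N : ℝ) ^ p * r ^ (-α) := by ring

/-- (BKᵇ_{p,α}) ⟹ (BKᶠ_{p,α}). [formal bookkeeping] -/
theorem bathKernelFloor_of_bathKernelBound {p α : ℝ} (hB : BathKernelBound p α) : BathKernelFloor p α := by
  intro ω₂ lam β γ hω hl hβ hγ T hT
  obtain ⟨A, r₀, hr₀, N₀, hA⟩ := hB ω₂ lam β γ hω hl hβ hγ T hT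
  exact ⟨A, r₀, hr₀, N₀, fun N hN r hr => (abs_le.1 (hA N hN r hr)).1⟩

/-- ★ **(FCᶜ_{p,α}) ⟹ (BKᶠ_{p,α})**. [this cell] -/
theorem bathKernelFloor_of_bathForecastCeiling {p α : ℝ} (hF : BathForecastCeiling p α) : BathKernelFloor p α :=
  bathKernelFloor_of_bathKernelBound (bathKernelBound_of_bathForecastCeiling hF)

/-- ★ **(BKᵇ_{p,α}) ⟹ (BTᶜ_{max(p,0)+4−2α})** for `1 < α < 2` — the ceiling twin of `bathTailFloor_of_bathKernelFloor` (same bookkeeping: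
`|K_N| ≤ 2T²` before `r₀`, the decay bound after, `∫ min(r,t)·r^{−α} = t^{2−α}·c_α`). [this cell] -/
theorem bathTailCeiling_of_bathKernelBound {p α : ℝ} (hα₁ : 1 < α) (hα₂ : α < 2) (hK : BathKernelBound p α) :
    BathTailCeiling (max p 0 + 4 - 2 * α) := by
  intro ω₂ lam β γ hω hl hβ hγ T hT c hc
  obtain ⟨A, r₀, hr₀, N₀, hA⟩ := hK ω₂ lam β γ hω hl hβ hγ T hT
  set Cα : ℝ := ∫ u in Ioi (0 : ℝ), min u 1 * u ^ (-α) with hCα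
  have hCα0 : 0 ≤ Cα :=
    setIntegral_nonneg measurableSet_Ioi fun u hu =>
      mul_nonneg (le_min (le_of_lt hu) zero_le_one) (Real.rpow_nonneg (le_of_lt hu) _)
  refine ⟨γ ^ 2 * ((max A 0 + 2 * T ^ 2 * r₀ ^ α) * (c ^ (2 - α) * Cα)), max N₀ 1, fun N hN => ?_⟩
  have hNN₀ : N₀ ≤ N := le_trans (le_max_left _ _) hN
  have hN1' : 1 ≤ N := le_trans (le_max_right _ _) hN
  have hN1 : (1 : ℝ) ≤ N := by exact_mod_cast hN1'
  have hNpos : (0 : ℝ) < N := by linarith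
  set t := c * (N : ℝ) ^ 2 with htdef
  have ht : 0 < t := by positivity
  obtain ⟨-, habs, -⟩ := bathKinCorr_basics hω hl hβ hγ hT (N := N) (by omega)
  set A'' : ℝ := max A 0 * (N : ℝ) ^ p + 2 * T ^ 2 * r₀ ^ α with hA''
  have hNp : 0 ≤ (N : ℝ) ^ p := Real.rpow_nonneg hNpos.le p
  have hceil : ∀ r : ℝ, 0 < r → bathKinCorr ω₂ lam β γ T N r ≤ A'' * (r ^ (-α)) := by
    intro r hr
    have hrα : 0 ≤ r ^ (-α) := Real.rpow_nonneg hr.le _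
    have h1 : 0 ≤ max A 0 * (N : ℝ) ^ p * r ^ (-α) := by positivity
    have h2 : 0 ≤ 2 * T ^ 2 * r₀ ^ α * r ^ (-α) := by positivity
    rcases le_or_gt r₀ r with hr₀r | hrr₀
    · have h3 := (abs_le.1 (hA N hNN₀ r hr₀r)).2
      have h4 : A * (N : ℝ) ^ p * r ^ (-α) ≤ max A 0 * (N : ℝ) ^ p * r ^ (-α) :=
        mul_le_mul_of_nonneg_right (mul_le_mul_of_nonneg_right (le_max_left _ _) hNp) hrα
      rw [hA'']
      nlinarith
    · have h4 : 1 ≤ r₀ ^ α * r ^ (-α) := by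
        rw [Real.rpow_neg hr.le, ← div_eq_mul_inv, ← Real.div_rpow hr₀.le hr.le]
        exact Real.one_le_rpow (by rw [le_div_iff₀ hr]; linarith) (by linarith)
      have h5 := (abs_le.1 (habs r)).2
      have hT2 : 0 ≤ 2 * T ^ 2 := by positivity
      rw [hA'']
      nlinarith [mul_le_mul_of_nonneg_left h4 hT2]
  have hLi : IntegrableOn (fun r : ℝ => min r t * (A'' * r ^ (-α))) (Ioi 0) := by
    have h0 : IntegrableOn (fun r : ℝ => A'' * (min r t * r ^ (-α))) (Ioi 0) :=
      (integrableOn_min_mul_rpow hα₁ hα₂ ht).const_mul A''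
    refine h0.congr_fun (fun r _ => ?_) measurableSet_Ioi
    show A'' * (min r t * r ^ (-α)) = min r t * (A'' * r ^ (-α))
    ring
  have hcl := bathTail_le_of_ceiling hω hl hβ hγ hT (N := N) (by omega) ht.le hLi hceil
  have hval : ∫ r in Ioi (0 : ℝ), min r t * (A'' * r ^ (-α)) = A'' * (t ^ (2 - α) * Cα) := by
    rw [← integral_min_mul_rpow_eq ht, ← integral_const_mul]
    refine integral_congr_ae (Eventually.of_forall fun r => ?_)
    show min r t * (A'' * r ^ (-α)) = A'' * (min r t * r ^ (-α))
    ring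
  rw [hval] at hcl
  have hA''0 : 0 ≤ A'' := by positivity
  have ht2 : t ^ (2 - α) = c ^ (2 - α) * (N : ℝ) ^ (4 - 2 * α) := by
    rw [htdef, Real.mul_rpow hc.le (sq_nonneg _), show ((N : ℝ) ^ 2) = (N : ℝ) ^ ((2 : ℕ) : ℝ) from
      (Real.rpow_natCast _ 2).symm, ← Real.rpow_mul hNpos.le]
    norm_num
    left
    ring_nf
  have hmax : A'' ≤ (max A 0 + 2 * T ^ 2 * r₀ ^ α) * (N : ℝ) ^ (max p 0) := by
    have h1 : (N : ℝ) ^ p ≤ (N : ℝ) ^ (max p 0) := Real.rpow_le_rpow_of_exponent_le hN1 (le_max_left _ _)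
    have h2 : 1 ≤ (N : ℝ) ^ (max p 0) := Real.one_le_rpow hN1 (le_max_right _ _)
    have h3 : 0 ≤ 2 * T ^ 2 * r₀ ^ α := by positivity
    rw [hA'']
    nlinarith [mul_le_mul_of_nonneg_left h1 (le_max_right A 0), mul_le_mul_of_nonneg_left h2 h3]
  have hsplit : (N : ℝ) ^ (max p 0 + 4 - 2 * α) = (N : ℝ) ^ (max p 0) * (N : ℝ) ^ (4 - 2 * α) := by
    rw [show max p 0 + 4 - 2 * α = max p 0 + (4 - 2 * α) by ring, Real.rpow_add hNpos]
  rw [hsplit]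
  have hcC : 0 ≤ c ^ (2 - α) * Cα := mul_nonneg (Real.rpow_nonneg hc.le _) hCα0
  have hN4 : 0 ≤ (N : ℝ) ^ (4 - 2 * α) := Real.rpow_nonneg hNpos.le _
  have key : A'' * (t ^ (2 - α) * Cα) ≤ (max A 0 + 2 * T ^ 2 * r₀ ^ α) * (c ^ (2 - α) * Cα) *
      ((N : ℝ) ^ (max p 0) * (N : ℝ) ^ (4 - 2 * α)) := by
    rw [ht2]
    have := mul_le_mul_of_nonneg_right hmax (mul_nonneg hcC hN4)
    nlinarith
  have hγ2 : 0 ≤ γ ^ 2 := sq_nonneg γ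
  nlinarith [mul_le_mul_of_nonneg_left key hγ2]

/-- ★ **(BKᵇ_{0,3/2}) ⟹ (BTᶜ_1) ∧ (BTᶠ_1)**: the two-sided diffusive kernel bound controls the bath tail at grade 1 on both sides. [this cell] -/
theorem bathTail_one_of_bathKernelBound (hK : BathKernelBound 0 (3 / 2)) : BathTailCeiling 1 ∧ BathTailFloor 1 := by
  have h1 := bathTailCeiling_of_bathKernelBound (by norm_num) (by norm_num) hK
  have h2 := bathTailFloor_of_bathKernelFloor (by norm_num) (by norm_num) (bathKernelFloor_of_bathKernelBound hK)
  rw [show max (0 : ℝ) 0 + 4 - 2 * (3 / 2) = 1 by norm_num] at h1 h2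
  exact ⟨h1, h2⟩

/-- ★★ **(FCᶜ_{0,3/2}) ⟹ (11071 ⟺ (BHᴾ_1))** — beneath the N-uniform diffusive decay of the boundary energy forecast, the blocker IS normal
heat exchange with one bath (`W_N(cN²) = O(N)`), with no (S) involved. [this cell] -/
theorem boundedResponse_iff_bathHeatPoint_of_bathForecastCeiling (hF : BathForecastCeiling 0 (3 / 2)) :
    BoundedResponse ↔ BathHeatPoint 1 := by
  obtain ⟨hC, hFl⟩ := bathTail_one_of_bathKernelBound (bathKernelBound_of_bathForecastCeiling hF)
  exact boundedResponse_iff_bathHeatPoint_of_bathTail hC hFl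

/-- ★★ **(S) ∧ (FCᶜ_{0,3/2}) ⟹ 11071** — the (S)-door in forecast currency. [this cell] -/
theorem boundedResponse_of_subdiffusiveBondHeat_bathForecastCeiling (hS : SubdiffusiveBondHeat)
    (hF : BathForecastCeiling 0 (3 / 2)) : BoundedResponse :=
  boundedResponse_of_subdiffusiveBondHeat_bathKernelFloor hS (bathKernelFloor_of_bathForecastCeiling hF)

/-- **(FCᶜ_{0,3/2}) ⟹ (11071 ⟺ (HSᴾ_3))** — with the transfer of §3: beneath the forecast ceiling the blocker is the normal SPREADING of the
total Helfand moment at the Thouless time. [this cell] -/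
theorem boundedResponse_iff_heatSpreadPoint_of_bathForecastCeiling (hF : BathForecastCeiling 0 (3 / 2)) :
    BoundedResponse ↔ HeatSpreadPoint 3 := by
  rw [boundedResponse_iff_bathHeatPoint_of_bathForecastCeiling hF, show (3 : ℝ) = 1 + 2 by norm_num]
  exact (heatSpreadPoint_iff_bathHeatPoint le_rfl).symm

end ForecastConsequences

end Summit.AtomisticToContinuum.FouriersLaw.Theorems.BoundedResponse.HeatSpreading

end
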